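import Mathlib.Analysis.Matrix.HermitianFunctionalCalculus
import Mathlib.Analysis.InnerProductSpace.Positive
import HarnessLib

/-!
# The CANONICAL spectral weight `g(D†D)` of a linear map `D : ℝⁿ → W` via Mathlib's matrix functional calculus
# (covariant programme, brick c4(iii)-weight: the trial exponent `q_D(G) = ⟨D†G, g(D†D) D†G⟩ = Σᵢ g(λᵢ)⟨Deᵢ, G⟩²`)

Cell `ym-fleet`, crux `TwistedTraceScaling` (stmt-QuantumFields-20203), line «twolattice», stub S-BASE, lane B = COARSE-LOWER(L₁)
(design note `pub/ym-fleet/ym-20203-coarse-s1/LOWER-BLUEPRINT.md` §5–§6).  HONEST FRAMING: finite-dimensional spectral calculus packaged for the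
covariant trial state; a stub of a child of the CONDITIONAL reduction route (femto rung R2b1); not a gap, not Clay.

WHY.  The covariant trial state is `H(U) = exp(−q_{D_U}(F(U)))·…` with `q_D(G) = Σᵢ ĉ(λᵢ) ⟨D eᵢ, G⟩²` summed over an eigenframe
`(eᵢ, λᵢ)` of `D†D` (`D = D_U` the covariant curl; file `…HarmonicStepFrame` does the step bookkeeping in such a frame, file
`…HarmonicStepMode` integrates it).  For `H` to be a FUNCTION of `U` (measurable, gauge invariant) the value must not depend on the
chosen frame: this file defines it through the functional calculus of the Gram matrix and proves the frame formula for EVERY eigenframe.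

* `gramMatrix D` — the matrix of `D†D` on `EuclideanSpace ℝ n` (real symmetric: `gramMatrix_isHermitian`; `toEuclideanLin_gramMatrix`);
  `gram_frame` — Mathlib's eigenbasis of it is an eigenframe of `D†D` in the sense of `…HarmonicStepFrame` (`D†D eᵢ = λᵢ eᵢ`);
* `spectralWeight g D = cfc g (gramMatrix D)` (Mathlib `Matrix.IsHermitian.cfc`; ANY `g : ℝ → ℝ` — the spectrum is finite) and
  ★ `spectralWeightLin_apply_of_eigenvector` — it acts on EVERY eigenvector of `D†D` with eigenvalue `μ` as multiplication by `g μ`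
  (not only on the chosen basis: eigenvectors for different eigenvalues of a symmetric operator are orthogonal);
* `weightForm g D G = ⟨D†G, g(D†D) D†G⟩` and ★ `weightForm_eq_sum` — `= Σᵢ g(λᵢ) ⟨D eᵢ, G⟩²` for EVERY orthonormal eigenframe;
  `weightForm_nonneg` (`g ≥ 0`);
* ★ `weightForm_congr_isometry` — COVARIANCE: if `D' ∘ R_V = R_W ∘ D` for linear isometries `R_V` (onto) and `R_W`, then
  `q_{D'}(R_W G) = q_D(G)` (with `D = D_U`, `D' = D_{U^g}`, `R_V = rotLink g`, `R_W = rotPlaq g` — tree `Cov.covCurl_gaugeTransform_eq` — this is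
  gauge invariance of the trial exponent).
Continuity of `D ↦ spectralWeight g D` on configurations whose Gram spectrum stays in a compact set where `g` is continuous is Mathlib's
`continuousOn_cfc` (scoped instance `Matrix.instIsometricContinuousFunctionalCalculus`); it is invoked where `H(U)` is assembled, not here.

## References
* R. A. Horn, C. R. Johnson, *Matrix Analysis* (2nd ed., 2013), Thm 4.1.5 (spectral theorem for Hermitian matrices; functions of a
  Hermitian matrix through its diagonalisation), Thm 7.3.2 (singular values via `D†D`). [HornJohnson2013]
* M. Lüscher, Nucl. Phys. B219 (1983) 233, §3. [Luscher1983]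
-/

noncomputable section

open Matrix
open scoped RealInnerProductSpace

namespace Summit.QuantumFields.YangMills.Theorems.FemtoTransferGap.TwoLattice.Harm

variable {n : Type*} [Fintype n] [DecidableEq n]
variable {W : Type*} [NormedAddCommGroup W] [InnerProductSpace ℝ W] [FiniteDimensional ℝ W]

/-! ## §1 The Gram matrix of `D` and its eigenframe -/

/-- The Gram matrix of `D : ℝⁿ → W`: the matrix of `D†D` in the standard basis of `EuclideanSpace ℝ n`. [cite: HornJohnson2013, Thm 7.3.2] -/
def gramMatrix (D : EuclideanSpace ℝ n →ₗ[ℝ] W) : Matrix n n ℝ :=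
  Matrix.toEuclideanLin.symm (D.adjoint ∘ₗ D)

/-- The Gram matrix represents `D†D`. [cite: HornJohnson2013, Thm 7.3.2] -/
theorem toEuclideanLin_gramMatrix (D : EuclideanSpace ℝ n →ₗ[ℝ] W) :
    Matrix.toEuclideanLin (gramMatrix D) = D.adjoint ∘ₗ D :=
  LinearEquiv.apply_symm_apply _ _

/-- Pointwise: `toEuclideanLin (gramMatrix D) x = D†(D x)`. [cite: HornJohnson2013, Thm 7.3.2] -/
theorem toEuclideanLin_gramMatrix_apply (D : EuclideanSpace ℝ n →ₗ[ℝ] W) (x : EuclideanSpace ℝ n) :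
    Matrix.toEuclideanLin (gramMatrix D) x = D.adjoint (D x) := by
  rw [toEuclideanLin_gramMatrix]; rfl

/-- The Gram matrix is real symmetric (Hermitian). [cite: HornJohnson2013, Thm 7.3.2] -/
theorem gramMatrix_isHermitian (D : EuclideanSpace ℝ n →ₗ[ℝ] W) : (gramMatrix D).IsHermitian := by
  rw [← Matrix.isSymmetric_toEuclideanLin_iff, toEuclideanLin_gramMatrix]
  exact (LinearMap.isPositive_adjoint_comp_self D).isSymmetric

/-- The Gram matrix is self-adjoint (the `cfc` predicate). [cite: HornJohnson2013, Thm 7.3.2] -/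
theorem gramMatrix_isSelfAdjoint (D : EuclideanSpace ℝ n →ₗ[ℝ] W) : IsSelfAdjoint (gramMatrix D) :=
  (gramMatrix_isHermitian D).isSelfAdjoint

/-- Matrix action versus operator action: `A *ᵥ x = λ • x` (as functions) gives `toEuclideanLin A x = λ • x`. [folklore] -/
theorem toEuclideanLin_eq_smul_of_mulVec {A : Matrix n n ℝ} {x : EuclideanSpace ℝ n} {μ : ℝ}
    (h : A *ᵥ (WithLp.ofLp x) = μ • WithLp.ofLp x) : Matrix.toEuclideanLin A x = μ • x := by
  rw [Matrix.toLpLin_apply, h, WithLp.toLp_smul, WithLp.toLp_ofLp]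

/-- ★ Mathlib's orthonormal eigenbasis of the Gram matrix is an EIGENFRAME of `D†D` (hypothesis `hD` of `…HarmonicStepFrame`):
`D†(D eᵢ) = λᵢ eᵢ`. [cite: HornJohnson2013, Thm 4.1.5] -/
theorem gram_frame (D : EuclideanSpace ℝ n →ₗ[ℝ] W) (i : n) :
    D.adjoint (D ((gramMatrix_isHermitian D).eigenvectorBasis i)) =
      (gramMatrix_isHermitian D).eigenvalues i • (gramMatrix_isHermitian D).eigenvectorBasis i := by
  rw [← toEuclideanLin_gramMatrix_apply]
  exact toEuclideanLin_eq_smul_of_mulVec ((gramMatrix_isHermitian D).mulVec_eigenvectorBasis i)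

/-- The Gram eigenvalues are `λᵢ = ‖D eᵢ‖² ≥ 0`. [cite: HornJohnson2013, Thm 7.3.2] -/
theorem gram_eigenvalues_nonneg (D : EuclideanSpace ℝ n →ₗ[ℝ] W) (i : n) : 0 ≤ (gramMatrix_isHermitian D).eigenvalues i := by
  set e := (gramMatrix_isHermitian D).eigenvectorBasis with he
  have h : ⟪e i, D.adjoint (D (e i))⟫ = ‖D (e i)‖ ^ 2 := by
    rw [LinearMap.adjoint_inner_right, real_inner_self_eq_norm_sq]
  rw [he, gram_frame D i, inner_smul_right, real_inner_self_eq_norm_sq, e.orthonormal.1 i, one_pow, mul_one] at h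
  rw [h]; positivity

/-! ## §2 The spectral weight `g(D†D)` -/

/-- **The spectral weight** `g(D†D)` as a matrix: Mathlib's continuous functional calculus of the Gram matrix (for a matrix every
`g : ℝ → ℝ` qualifies — the spectrum is finite). [cite: HornJohnson2013, Thm 4.1.5] -/
def spectralWeight (g : ℝ → ℝ) (D : EuclideanSpace ℝ n →ₗ[ℝ] W) : Matrix n n ℝ :=
  cfc g (gramMatrix D)

/-- `g(D†D)` as an operator on `EuclideanSpace ℝ n`. [cite: HornJohnson2013, Thm 4.1.5] -/
def spectralWeightLin (g : ℝ → ℝ) (D : EuclideanSpace ℝ n →ₗ[ℝ] W) : EuclideanSpace ℝ n →ₗ[ℝ] EuclideanSpace ℝ n :=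
  Matrix.toEuclideanLin (spectralWeight g D)

/-- The functional calculus acts diagonally on the CHOSEN eigenbasis: `cfc g A *ᵥ bⱼ = g(λⱼ) bⱼ`. [cite: HornJohnson2013, Thm 4.1.5] -/
theorem cfc_mulVec_eigenvectorBasis {A : Matrix n n ℝ} (hA : A.IsHermitian) (g : ℝ → ℝ) (j : n) :
    (cfc g A) *ᵥ (WithLp.ofLp (hA.eigenvectorBasis j)) = g (hA.eigenvalues j) • WithLp.ofLp (hA.eigenvectorBasis j) := by
  rw [hA.cfc_eq, Matrix.IsHermitian.cfc, Unitary.conjStarAlgAut_apply, ← mulVec_mulVec, ← mulVec_mulVec,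
    hA.star_eigenvectorUnitary_mulVec, diagonal_mulVec_single, ← hA.eigenvectorUnitary_mulVec, ← mulVec_smul]
  congr 1
  ext i
  simp [Pi.single_apply]

/-- `g(D†D) eᵢ = g(λᵢ) eᵢ` on the canonical eigenbasis. [cite: HornJohnson2013, Thm 4.1.5] -/
theorem spectralWeightLin_apply_eigenvectorBasis (g : ℝ → ℝ) (D : EuclideanSpace ℝ n →ₗ[ℝ] W) (i : n) :
    spectralWeightLin g D ((gramMatrix_isHermitian D).eigenvectorBasis i) =
      g ((gramMatrix_isHermitian D).eigenvalues i) • (gramMatrix_isHermitian D).eigenvectorBasis i :=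
  toEuclideanLin_eq_smul_of_mulVec (cfc_mulVec_eigenvectorBasis (gramMatrix_isHermitian D) g i)

/-- `g(D†D)` in the canonical eigenbasis: `g(D†D) x = Σᵢ g(λᵢ) ⟨eᵢ, x⟩ eᵢ`. [cite: HornJohnson2013, Thm 4.1.5] -/
theorem spectralWeightLin_apply_eq_sum (g : ℝ → ℝ) (D : EuclideanSpace ℝ n →ₗ[ℝ] W) (x : EuclideanSpace ℝ n) :
    spectralWeightLin g D x =
      ∑ i, (g ((gramMatrix_isHermitian D).eigenvalues i) * ⟪(gramMatrix_isHermitian D).eigenvectorBasis i, x⟫) •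
        (gramMatrix_isHermitian D).eigenvectorBasis i := by
  set e := (gramMatrix_isHermitian D).eigenvectorBasis with he
  conv_lhs => rw [← e.sum_repr' x]
  rw [map_sum]
  refine Finset.sum_congr rfl fun i _ => ?_
  rw [map_smul, he, spectralWeightLin_apply_eigenvectorBasis, smul_smul, mul_comm]

/-- Eigenvectors of the symmetric `D†D` for an eigenvalue `μ` are orthogonal to the basis eigenvectors with `λᵢ ≠ μ`:
`D†D v = μ v`, `λᵢ ≠ μ ⇒ ⟨eᵢ, v⟩ = 0`. [cite: HornJohnson2013, Thm 4.1.5] -/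
theorem inner_eigenvectorBasis_eq_zero_of_ne (D : EuclideanSpace ℝ n →ₗ[ℝ] W) {v : EuclideanSpace ℝ n} {μ : ℝ}
    (hv : D.adjoint (D v) = μ • v) {i : n} (hi : (gramMatrix_isHermitian D).eigenvalues i ≠ μ) :
    ⟪(gramMatrix_isHermitian D).eigenvectorBasis i, v⟫ = 0 := by
  set e := (gramMatrix_isHermitian D).eigenvectorBasis with he
  have h1 : ⟪e i, D.adjoint (D v)⟫ = μ * ⟪e i, v⟫ := by rw [hv, inner_smul_right]
  have h2 : ⟪e i, D.adjoint (D v)⟫ = (gramMatrix_isHermitian D).eigenvalues i * ⟪e i, v⟫ := by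
    rw [LinearMap.adjoint_inner_right, ← LinearMap.adjoint_inner_left, he, gram_frame D i, inner_smul_left]
    rfl
  have h3 : ((gramMatrix_isHermitian D).eigenvalues i - μ) * ⟪e i, v⟫ = 0 := by rw [sub_mul, ← h2, h1, sub_self]
  rcases mul_eq_zero.mp h3 with h | h
  · exact absurd (sub_eq_zero.mp h) hi
  · exact h

/-- ★ **`g(D†D)` ACTS ON EVERY EIGENVECTOR**: `D†D v = μ v ⇒ g(D†D) v = g(μ) v` (any `v`, not only the chosen basis).
[cite: HornJohnson2013, Thm 4.1.5] -/
theorem spectralWeightLin_apply_of_eigenvector (g : ℝ → ℝ) (D : EuclideanSpace ℝ n →ₗ[ℝ] W) {v : EuclideanSpace ℝ n} {μ : ℝ}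
    (hv : D.adjoint (D v) = μ • v) : spectralWeightLin g D v = g μ • v := by
  set e := (gramMatrix_isHermitian D).eigenvectorBasis with he
  rw [spectralWeightLin_apply_eq_sum]
  conv_rhs => rw [← e.sum_repr' v, Finset.smul_sum]
  refine Finset.sum_congr rfl fun i _ => ?_
  rw [smul_smul]
  by_cases hi : (gramMatrix_isHermitian D).eigenvalues i = μ
  · rw [hi]
  · rw [← he, inner_eigenvectorBasis_eq_zero_of_ne D hv hi, mul_zero, mul_zero]

/-! ## §3 The trial exponent `q_D(G) = ⟨D†G, g(D†D) D†G⟩` and its frame formula -/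

/-- **The trial exponent** `q_D(G) = ⟨D†G, g(D†D)·D†G⟩` (a function of `D` and `G` alone). [cite: Luscher1983, §3] -/
def weightForm (g : ℝ → ℝ) (D : EuclideanSpace ℝ n →ₗ[ℝ] W) (G : W) : ℝ :=
  ⟪D.adjoint G, spectralWeightLin g D (D.adjoint G)⟫

/-- ★ **THE FRAME FORMULA, FOR EVERY EIGENFRAME.**  If `e` is an orthonormal basis of `EuclideanSpace ℝ n` with `D†D eᵢ = λᵢ eᵢ`, then
`q_D(G) = Σᵢ g(λᵢ) ⟨D eᵢ, G⟩²` — independently of the frame. [cite: HornJohnson2013, Thm 4.1.5] -/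
theorem weightForm_eq_sum {ι : Type*} [Fintype ι] (g : ℝ → ℝ) (D : EuclideanSpace ℝ n →ₗ[ℝ] W) {e : OrthonormalBasis ι ℝ (EuclideanSpace ℝ n)}
    {lam : ι → ℝ} (hD : ∀ i, D.adjoint (D (e i)) = lam i • e i) (G : W) :
    weightForm g D G = ∑ i, g (lam i) * ⟪D (e i), G⟫ ^ 2 := by
  unfold weightForm
  set x := D.adjoint G with hx
  have hNx : spectralWeightLin g D x = ∑ i, (g (lam i) * ⟪e i, x⟫) • e i := by
    conv_lhs => rw [← e.sum_repr' x]
    rw [map_sum]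
    refine Finset.sum_congr rfl fun i _ => ?_
    rw [map_smul, spectralWeightLin_apply_of_eigenvector g D (hD i), smul_smul, mul_comm]
  rw [hNx, inner_sum]
  refine Finset.sum_congr rfl fun i _ => ?_
  have hφ : ⟪e i, x⟫ = ⟪D (e i), G⟫ := by rw [hx, LinearMap.adjoint_inner_right]
  rw [inner_smul_right, real_inner_comm (e i) x, hφ, sq]
  ring

/-- The frame formula in Mathlib's canonical eigenbasis of the Gram matrix. [cite: HornJohnson2013, Thm 4.1.5] -/
theorem weightForm_eq_sum_gram (g : ℝ → ℝ) (D : EuclideanSpace ℝ n →ₗ[ℝ] W) (G : W) :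
    weightForm g D G = ∑ i, g ((gramMatrix_isHermitian D).eigenvalues i) * ⟪D ((gramMatrix_isHermitian D).eigenvectorBasis i), G⟫ ^ 2 :=
  weightForm_eq_sum g D (gram_frame D) G

/-- A non-negative weight function gives a non-negative exponent: `g ≥ 0 ⇒ q_D(G) ≥ 0`. [cite: HornJohnson2013, Thm 4.1.5] -/
theorem weightForm_nonneg {g : ℝ → ℝ} (hg : ∀ s, 0 ≤ g s) (D : EuclideanSpace ℝ n →ₗ[ℝ] W) (G : W) : 0 ≤ weightForm g D G := by
  rw [weightForm_eq_sum_gram]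
  exact Finset.sum_nonneg fun i _ => mul_nonneg (hg _) (sq_nonneg _)

/-- Monotonicity in the weight function: `g₁ ≤ g₂` pointwise ⇒ `q^{g₁}_D(G) ≤ q^{g₂}_D(G)` (a FATTER weight has the smaller exponent).
[cite: HornJohnson2013, Thm 4.1.5] -/
theorem weightForm_mono {g₁ g₂ : ℝ → ℝ} (hg : ∀ s, g₁ s ≤ g₂ s) (D : EuclideanSpace ℝ n →ₗ[ℝ] W) (G : W) :
    weightForm g₁ D G ≤ weightForm g₂ D G := by
  rw [weightForm_eq_sum_gram, weightForm_eq_sum_gram]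
  exact Finset.sum_le_sum fun i _ => mul_le_mul_of_nonneg_right (hg _) (sq_nonneg _)

/-- Scaling the weight function scales the exponent: `q^{c·g} = c·q^{g}`. [cite: HornJohnson2013, Thm 4.1.5] -/
theorem weightForm_const_mul (c : ℝ) (g : ℝ → ℝ) (D : EuclideanSpace ℝ n →ₗ[ℝ] W) (G : W) :
    weightForm (fun s => c * g s) D G = c * weightForm g D G := by
  rw [weightForm_eq_sum_gram, weightForm_eq_sum_gram, Finset.mul_sum]
  exact Finset.sum_congr rfl fun i _ => by ring

/-! ## §4 Covariance under isometries (gauge invariance of the trial exponent) -/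

section Covariance

variable {m : Type*} [Fintype m] [DecidableEq m]

omit [DecidableEq n] [DecidableEq m] in
/-- Transport of an eigenframe: if `D' (R_V w) = R_W (D w)` for a linear isometry equivalence `R_V` and a linear isometry `R_W`, and
`D†D eᵢ = λᵢ eᵢ`, then `D'†D' (R_V eᵢ) = λᵢ (R_V eᵢ)`. [cite: HornJohnson2013, Thm 7.3.2] -/
theorem frame_transport {D : EuclideanSpace ℝ n →ₗ[ℝ] W} {D' : EuclideanSpace ℝ m →ₗ[ℝ] W}
    (RV : EuclideanSpace ℝ n ≃ₗᵢ[ℝ] EuclideanSpace ℝ m) (RW : W →ₗᵢ[ℝ] W) (hcov : ∀ w, D' (RV w) = RW (D w))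
    {ι : Type*} [Fintype ι] {e : OrthonormalBasis ι ℝ (EuclideanSpace ℝ n)} {lam : ι → ℝ}
    (hD : ∀ i, D.adjoint (D (e i)) = lam i • e i) (i : ι) :
    D'.adjoint (D' (RV (e i))) = lam i • RV (e i) := by
  refine ext_inner_left ℝ fun x => ?_
  have hx : x = RV (RV.symm x) := (RV.apply_symm_apply x).symm
  rw [LinearMap.adjoint_inner_right, hx, hcov, hcov, RW.inner_map_map, ← LinearMap.adjoint_inner_right, hD i,
    inner_smul_right, inner_smul_right, RV.inner_map_map]

/-- ★ **COVARIANCE OF THE TRIAL EXPONENT**: `D' ∘ R_V = R_W ∘ D` (linear isometries, `R_V` onto) ⇒ `q_{D'}(R_W G) = q_D(G)`.  With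
`D = D_U`, `D' = D_{U^g}`, `R_V = rotLink g`, `R_W = rotPlaq g` (tree `Cov.covCurl_gaugeTransform_eq`) this is GAUGE INVARIANCE of the
covariant trial state's exponent. [cite: Luscher1983, §3] -/
theorem weightForm_congr_isometry (g : ℝ → ℝ) {D : EuclideanSpace ℝ n →ₗ[ℝ] W} {D' : EuclideanSpace ℝ m →ₗ[ℝ] W}
    (RV : EuclideanSpace ℝ n ≃ₗᵢ[ℝ] EuclideanSpace ℝ m) (RW : W →ₗᵢ[ℝ] W) (hcov : ∀ w, D' (RV w) = RW (D w)) (G : W) :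
    weightForm g D' (RW G) = weightForm g D G := by
  set e := (gramMatrix_isHermitian D).eigenvectorBasis
  have hD := gram_frame D
  have hD' := frame_transport RV RW hcov hD
  have he' : ∀ i, (e.map RV) i = RV (e i) := fun i => by simp [e]
  have hD'' : ∀ i, D'.adjoint (D' ((e.map RV) i)) = (gramMatrix_isHermitian D).eigenvalues i • (e.map RV) i := fun i => by
    rw [he']; exact hD' i
  rw [weightForm_eq_sum g D' hD'' (RW G), weightForm_eq_sum g D hD G]
  refine Finset.sum_congr rfl fun i _ => ?_
  rw [he', hcov, RW.inner_map_map]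

end Covariance

end Summit.QuantumFields.YangMills.Theorems.FemtoTransferGap.TwoLattice.Harm

end
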